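import Mathlib
import Summits.PneNP.PneNP.Theorems.ConvexRankGatesLinAlgGateBlindDenseRegime

/-!
# Route ConvexRankGates, crux `LinAlgGateBlind` (stmt-PneNP-10681): the SMALL-CLAUSE DOOR — a class-free single-gate criterion (supports)

A second door of the crux that is not capped in the gate dimension and, unlike the program door
(`Theorems/ConvexRankGatesLinAlgGateBlindProgramDoor.lean`), assumes NO monotone program: it reads the term gate
`O` through any CNF over clique atoms, `O(x) = ⋀_{L ∈ 𝒦} ⋁_{Z ∈ L} ⌈Z⌉` (`𝒦` = any family of clauses, e.g. the
maxterms of `O`; atoms `Z ∈ 𝒱(l)`), and splits the clauses at a size threshold `s`: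

* `card_fatHit_le` — **fat transversals are rare** (the counting heart, in the style of Alon–Boppana's
  Lemma 3.13): among the `k`-sets `S` whose sub-atoms hit every clause of a family of clauses of size `≤ s`,
  those admitting NO hitting sub-atom system on `≤ l` vertices number at most `s^{l+1}·C(m-l-1, k-l-1)`
  (greedy encoding: the first unhit clause offers `≤ s` atoms, each not inside the current set, so the support
  grows; after `≤ l + 1` steps it exceeds `l`);
* `sg_of_smallClauses` — hence with `𝒜 := {X ∈ 𝒱(l) : the atoms inside X hit every clause of size ≤ s}`:
  `#lostPos ≤ s^{l+1}·C(m-l-1, k-l-1)` and `gainedNeg ≤ Pr_{G(m,q)}[some clause of size > s has all its atoms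
  absent]` — if some `X ∈ 𝒜` is a clique of `G`, every small clause has a present atom, so `O(G) = 0` needs
  a big clause to fail entirely;
* `fatHit_budget` — in the line's regime, `(k⁶)^{l+1}·C(m-l-1, k-l-1) ≤ ε_c(m)·C(m,k)` eventually (threshold
  `s = k⁶ = ⌈m^{1/8}⌉⁶ ≥ m^{3/4}`);
* `sgClause_of_smallClauses` (registered) — `∀ c, ∀ᶠ m`: every `O` with a CNF over `𝒱(lOf m)`-atoms whose
  clauses of MORE than `(kOf m)^6` atoms are jointly all-absent in `G(m, qOf m)` with probability `≤ epsOf c m`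
  satisfies the single-gate clause at budget `epsOf c m`. In particular (`sgClause_of_clauses_card_le`,
  registered) EVERY monotone term gate all of whose clauses have `≤ (kOf m)^6` atoms satisfies it, whatever
  its class and monotone complexity.

Reading for the crux: a violator of `SG_PERM` / `SG_GRANK` must (i) have super-polynomial monotone program
complexity over its atom-ORs (program door) AND (ii) owe its rejection of `G(m,q)` to maxterms of more than
`m^{3/4}` atoms that fail jointly with probability `> ε` ("big-only fragility") — for a PERM term gate a maxterm
is the set of atoms whose generators leave a maximal `τ`-free subgroup, so (ii) says: the generated group of
`G(m,q)` is confined to a `τ`-free subgroup missing `> m^{3/4}` atoms with probability `> ε`, while no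
`τ`-free subgroup missing `≤ m^{3/4}` atoms matters. Sources: A. A. Razborov (1985); N. Alon, R. B. Boppana,
Combinatorica 7 (1987), Lemma 3.13 (counting pattern); S. Jukna, *Boolean Function Complexity* (2012),
Thm. 9.26 (superset count). No new definitions; nothing is assumed. [folklore]
-/

-- `Summit.PneNP.PneNP.…` duplicates `PneNP` BY DESIGN (single-problem summit).
set_option linter.dupNamespace false

noncomputable section

namespace Summit.PneNP.PneNP.Theorems

open Finset Filter Literature.Computability.Complexity Razborov
open Summit.PneNP.PneNP.Cruxes.LinAlgGateBlind.DnfInvariantWideGatesSeeSmallCliques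

/-! ### Fat transversals are rare -/

/-- **Fat transversals are rare.** Let `𝒦` be a family of clauses, each a set of at most `s ≥ 1` vertex sets
("atoms"). A family `𝒮` of `k`-subsets `S ⊇ Y` of `Fin m` such that every clause has an atom inside `S` but NO
`X ⊆ S` with `#X ≤ l` has this property, has at most `s^n · C(m - (l+1), k - (l+1))` members whenever
`l + 1 ≤ #Y + n` (`l + 1 ≤ k ≤ m`). Induction on `n`: if `#Y > l` count the supersets of `Y`; otherwise some
clause has no atom inside `Y` (else `X = Y` would do), one of its `≤ s` atoms lies inside `S` and is not
inside `Y`, and the support grows. [folklore] -/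
theorem card_fatHit_le {m : ℕ} (𝒦 : Finset (Finset (Finset (Fin m)))) (s l k : ℕ) (hs1 : 1 ≤ s)
    (hs : ∀ L ∈ 𝒦, #L ≤ s) (hkm : k ≤ m) :
    ∀ (n : ℕ) (Y : Finset (Fin m)) (𝒮 : Finset (Finset (Fin m))), l + 1 ≤ #Y + n →
      (∀ S ∈ 𝒮, #S = k ∧ Y ⊆ S ∧ (∀ L ∈ 𝒦, ∃ Z ∈ L, Z ⊆ S) ∧
        ¬ ∃ X ⊆ S, #X ≤ l ∧ ∀ L ∈ 𝒦, ∃ Z ∈ L, Z ⊆ X) →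
      #𝒮 ≤ s ^ n * (m - (l + 1)).choose (k - (l + 1)) := by
  classical
  -- supersets of a set with more than `l` elements
  have hsup : ∀ (n : ℕ) (Y : Finset (Fin m)) (𝒮 : Finset (Finset (Fin m))), l + 1 ≤ #Y →
      (∀ S ∈ 𝒮, #S = k ∧ Y ⊆ S) → #𝒮 ≤ s ^ n * (m - (l + 1)).choose (k - (l + 1)) := by
    intro n Y 𝒮 hY h𝒮
    have h1 : 1 ≤ s ^ n := Nat.one_le_pow _ _ hs1
    by_cases hYk : #Y ≤ k
    · calc #𝒮 ≤ #((powersetCard k (univ : Finset (Fin m))).filter fun S => Y ⊆ S) :=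
            card_le_card fun S hS => mem_filter.2
              ⟨mem_powersetCard.2 ⟨subset_univ _, (h𝒮 S hS).1⟩, (h𝒮 S hS).2⟩
        _ ≤ (#(univ : Finset (Fin m)) - #Y).choose (k - #Y) :=
            card_filter_supset_powersetCard_le univ Y hYk
        _ = (m - #Y).choose (k - #Y) := by rw [card_univ, Fintype.card_fin]
        _ ≤ (m - (l + 1)).choose (k - (l + 1)) := choose_sub_le_choose_sub hY hYk hkm
        _ ≤ s ^ n * (m - (l + 1)).choose (k - (l + 1)) := Nat.le_mul_of_pos_left _ h1
    · have hempty : 𝒮 = ∅ := by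
        refine eq_empty_of_forall_notMem fun S hS => hYk ?_
        rw [← (h𝒮 S hS).1]
        exact card_le_card (h𝒮 S hS).2
      rw [hempty, card_empty]
      exact Nat.zero_le _
  intro n
  induction n with
  | zero =>
    intro Y 𝒮 hY h𝒮
    exact hsup 0 Y 𝒮 (by omega) fun S hS => ⟨(h𝒮 S hS).1, (h𝒮 S hS).2.1⟩
  | succ n ih =>
    intro Y 𝒮 hY h𝒮
    by_cases hYl : l + 1 ≤ #Y
    · exact hsup (n + 1) Y 𝒮 hYl fun S hS => ⟨(h𝒮 S hS).1, (h𝒮 S hS).2.1⟩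
    -- `#Y ≤ l`: either `Y` itself is a thin transversal support, or some clause is unhit inside `Y`
    by_cases hall : ∀ L ∈ 𝒦, ∃ Z ∈ L, Z ⊆ Y
    · have hempty : 𝒮 = ∅ :=
        eq_empty_of_forall_notMem fun S hS => (h𝒮 S hS).2.2.2 ⟨Y, (h𝒮 S hS).2.1, by omega, hall⟩
      rw [hempty, card_empty]
      exact Nat.zero_le _
    push Not at hall
    obtain ⟨L₀, hL₀, hunhit⟩ := hall
    -- every member contains `Y ∪ Z` for some atom `Z ∈ L₀`, `Z ⊄ Y`
    have hcover : 𝒮 ⊆ L₀.biUnion fun Z => 𝒮.filter fun S => Z ⊆ S := by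
      intro S hS
      obtain ⟨Z, hZ, hZS⟩ := (h𝒮 S hS).2.2.1 L₀ hL₀
      exact mem_biUnion.2 ⟨Z, hZ, mem_filter.2 ⟨hS, hZS⟩⟩
    calc #𝒮 ≤ ∑ Z ∈ L₀, #(𝒮.filter fun S => Z ⊆ S) := (card_le_card hcover).trans card_biUnion_le
      _ ≤ ∑ _Z ∈ L₀, s ^ n * (m - (l + 1)).choose (k - (l + 1)) := by
          refine sum_le_sum fun Z hZ => ih (Y ∪ Z) _ ?_ fun S hS => ?_
          · -- `Z ⊄ Y`, so the support grows
            have hlt : #Y < #(Y ∪ Z) := by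
              refine card_lt_card (Finset.ssubset_iff_subset_ne.2 ⟨subset_union_left, fun h => ?_⟩)
              exact hunhit Z hZ (h ▸ subset_union_right)
            omega
          · obtain ⟨hS𝒮, hZS⟩ := mem_filter.1 hS
            obtain ⟨hSk, hYS, hhit, hfat⟩ := h𝒮 S hS𝒮
            exact ⟨hSk, union_subset hYS hZS, hhit, hfat⟩
      _ = #L₀ * (s ^ n * (m - (l + 1)).choose (k - (l + 1))) := by rw [sum_const, smul_eq_mul]
      _ ≤ s * (s ^ n * (m - (l + 1)).choose (k - (l + 1))) := Nat.mul_le_mul_right _ (hs L₀ hL₀)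
      _ = s ^ (n + 1) * (m - (l + 1)).choose (k - (l + 1)) := by ring

/-! ### The door with explicit budgets -/

/-- **The small-clause door (explicit budgets).** Let `O(x) = 1 ↔ ∀ L ∈ 𝒦, ∃ Z ∈ L, ⌈Z⌉(x)` be a CNF of the
term gate over atoms `Z ∈ 𝒱(l)` and let `1 ≤ s`. With `𝒜 = {X ∈ 𝒱(l) : every clause of size ≤ s has an atom
inside X}`: a lost positive is a `k`-set hitting all small clauses but only fatly (`card_fatHit_le`), and a gained
negative needs a clause of size `> s` with all atoms absent. [folklore] -/
theorem sg_of_smallClauses (m k l s : ℕ) (q : ℝ) (hq0 : 0 ≤ q) (hq1 : q ≤ 1) (hs1 : 1 ≤ s)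
    (hkm : k ≤ m)
    (𝒦 : Finset (Finset (Finset (Fin m)))) (h𝒦 : ∀ L ∈ 𝒦, ∀ Z ∈ L, Z ∈ smallSets (Fin m) l)
    (O : (KEdge m → Bool) → Bool) (hO : ∀ x, O x = true ↔ ∀ L ∈ 𝒦, ∃ Z ∈ L, CliquePresent Z x) :
    ∃ 𝒜 ⊆ smallSets (Fin m) l,
      #(lostPos m k O 𝒜) ≤ s ^ (l + 1) * (m - (l + 1)).choose (k - (l + 1)) ∧
      gainedNeg m q O 𝒜 ≤
        prob q (fun x : KEdge m → Bool => ∃ L ∈ 𝒦, s < #L ∧ ∀ Z ∈ L, ¬ CliquePresent Z x) := by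
  classical
  set 𝒦s := 𝒦.filter fun L => #L ≤ s with h𝒦s
  refine ⟨(smallSets (Fin m) l).filter fun X => ∀ L ∈ 𝒦s, ∃ Z ∈ L, Z ⊆ X, filter_subset _ _, ?_, ?_⟩
  · -- lost positives hit every small clause, but only fatly
    have hsub : ∀ S ∈ lostPos m k O ((smallSets (Fin m) l).filter fun X => ∀ L ∈ 𝒦s, ∃ Z ∈ L, Z ⊆ X),
        #S = k ∧ ∅ ⊆ S ∧ (∀ L ∈ 𝒦s, ∃ Z ∈ L, Z ⊆ S) ∧
          ¬ ∃ X ⊆ S, #X ≤ l ∧ ∀ L ∈ 𝒦s, ∃ Z ∈ L, Z ⊆ X := by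
      intro S hS
      simp only [lostPos, mem_filter, mem_powersetCard] at hS
      obtain ⟨⟨-, hSk⟩, hOS, hacc⟩ := hS
      refine ⟨hSk, empty_subset _, fun L hL => ?_, fun ⟨X, hXS, hXl, hX⟩ => hacc ?_⟩
      · have hL𝒦 : L ∈ 𝒦 := (mem_filter.1 hL).1
        obtain ⟨Z, hZ, hZP⟩ := (hO _).1 hOS L hL𝒦
        exact ⟨Z, hZ, (cliquePresent_cliqueVec_iff (mem_smallSets.1 (h𝒦 L hL𝒦 Z hZ)).2).1 hZP⟩
      · -- a thin hitting set `X ⊆ S`: replace a singleton by `∅` to land in `𝒱(l)`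
        by_cases hX1 : #X = 1
        · refine ⟨∅, mem_filter.2 ⟨empty_mem_smallSets l, fun L hL => ?_⟩, cliquePresent_empty _⟩
          obtain ⟨Z, hZ, hZX⟩ := hX L hL
          have hZ1 : #Z ≠ 1 := (mem_smallSets.1 (h𝒦 L (mem_filter.1 hL).1 Z hZ)).2
          have hZ0 : Z = ∅ := by
            have hle : #Z ≤ 1 := hX1 ▸ card_le_card hZX
            have : #Z = 0 := by omega
            exact card_eq_zero.1 this
          exact ⟨Z, hZ, by rw [hZ0]⟩
        · exact ⟨X, mem_filter.2 ⟨mem_smallSets.2 ⟨hXl, hX1⟩, hX⟩,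
            (cliquePresent_cliqueVec_iff hX1).2 hXS⟩
    exact card_fatHit_le 𝒦s s l k hs1 (fun L hL => (mem_filter.1 hL).2) hkm (l + 1) ∅ _ (by simp) hsub
  · -- gained negatives need a big clause with all atoms absent
    refine prob_mono hq0 hq1 fun x hx => ?_
    obtain ⟨hOx, X, hX, hXx⟩ := hx
    have hX' := (mem_filter.1 hX).2
    have hfail : ∃ L ∈ 𝒦, ∀ Z ∈ L, ¬ CliquePresent Z x := by
      by_contra h
      push Not at h
      have := (hO x).2 fun L hL => h L hL
      rw [hOx] at this
      exact Bool.false_ne_true this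
    obtain ⟨L, hL, hLfail⟩ := hfail
    refine ⟨L, hL, ?_, hLfail⟩
    by_contra hLs
    push Not at hLs
    obtain ⟨Z, hZ, hZX⟩ := hX' L (mem_filter.2 ⟨hL, hLs⟩)
    exact hLfail Z hZ (hXx.anti hZX)

/-! ### The door in the line's regime: every `c` -/

/-- **Budget of the fat-transversal count at threshold `s = k⁶`**: eventually in `m`,
`(k⁶)^{l+1}·C(m-l-1, k-l-1) ≤ ε_c(m)·C(m,k)` (`k = ⌈m^{1/8}⌉ ≤ 2x²`, `x = m^{1/16} ≥ 2⁷`, `l ≥ 16c + 16`;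
`C(m-l-1,k-l-1)·m^{l+1} ≤ k^{l+1}·C(m,k)`). [folklore] -/
theorem fatHit_budget : ∀ c : ℕ, ∀ᶠ m : ℕ in atTop, ((((kOf m ^ 6) ^ (lOf m + 1) * (m - (lOf m + 1)).choose (kOf m - (lOf m + 1)) : ℕ) : ℝ)) ≤ epsOf c m * (m.choose (kOf m) : ℝ) := by
  intro c
  filter_upwards [denseRegime_params (8 * c + 4), eventually_ge_atTop 1,
    (DenseRegime.tendsto_rpow_sixteenth).eventually_ge_atTop (2 ^ 7 : ℝ)] with m hP hm hx
  obtain ⟨-, -, hc3, hl16⟩ := hP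
  set x := (m : ℝ) ^ (1 / 16 : ℝ) with hxdef
  set l := lOf m
  set k := kOf m
  have hx2 : (2 : ℝ) ≤ x := le_trans (by norm_num) hx
  have hlk : l + 1 ≤ k := DenseRegime.lOf_add_one_le_kOf hx2
  have hkm : k ≤ m := DenseRegime.kOf_le_self m
  have hnat := choose_sub_mul_pow_le_pow_mul_choose (l + 1) m k hlk hkm
  have hmx : (m : ℝ) = x ^ 16 := (DenseRegime.rpow_sixteenth_pow m).symm
  have hmpos : (0 : ℝ) < m := by exact_mod_cast hm
  have hx1 : (1 : ℝ) ≤ x := by linarith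
  have hk2 : (k : ℝ) ≤ 2 * x ^ 2 := DenseRegime.kOf_le_two_mul_sq hm
  have hreal : (((m - (l + 1)).choose (k - (l + 1)) : ℕ) : ℝ) * (m : ℝ) ^ (l + 1) ≤
      (k : ℝ) ^ (l + 1) * (m.choose k : ℝ) := by exact_mod_cast hnat
  have hC : (0 : ℝ) ≤ (m.choose k : ℝ) := Nat.cast_nonneg _
  have hl : 16 * c + 16 ≤ l := by omega
  -- the exponent bookkeeping: `(2x²)^{7(l+1)} · 4x^{16(c+1)} ≤ x^{16(l+1)}`
  have e1 : (2 * x ^ 2) ^ (7 * (l + 1)) = (2 : ℝ) ^ (7 * (l + 1)) * x ^ (14 * (l + 1)) := by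
    rw [mul_pow, ← pow_mul]
    congr 1
    congr 1
    ring
  have e2 : (4 : ℝ) * (x ^ 16) ^ (c + 1) = (2 : ℝ) ^ 2 * x ^ (16 * (c + 1)) := by
    rw [← pow_mul]; norm_num
  have e3 : (x ^ 16) ^ (l + 1) = x ^ (16 * (l + 1)) := by rw [← pow_mul]
  have key : (2 * x ^ 2) ^ (7 * (l + 1)) * (4 * (x ^ 16) ^ (c + 1)) ≤ (x ^ 16) ^ (l + 1) := by
    have h2x : (2 : ℝ) ^ (7 * (l + 1) + 2) ≤ x ^ (l + 2) := by
      calc (2 : ℝ) ^ (7 * (l + 1) + 2) ≤ (2 : ℝ) ^ (7 * (l + 2)) := pow_le_pow_right₀ (by norm_num) (by omega)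
        _ = ((2 : ℝ) ^ 7) ^ (l + 2) := by rw [pow_mul]
        _ ≤ x ^ (l + 2) := pow_le_pow_left₀ (by norm_num) hx _
    rw [e1, e2, e3]
    calc (2 : ℝ) ^ (7 * (l + 1)) * x ^ (14 * (l + 1)) * ((2 : ℝ) ^ 2 * x ^ (16 * (c + 1)))
        = (2 : ℝ) ^ (7 * (l + 1) + 2) * (x ^ (14 * (l + 1)) * x ^ (16 * (c + 1))) := by
          rw [pow_add]; ring
      _ ≤ x ^ (l + 2) * (x ^ (14 * (l + 1)) * x ^ (16 * (c + 1))) :=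
          mul_le_mul_of_nonneg_right h2x (by positivity)
      _ = x ^ (l + 2 + (14 * (l + 1) + 16 * (c + 1))) := by ring
      _ ≤ x ^ (16 * (l + 1)) := pow_le_pow_right₀ hx1 (by omega)
  rw [← mul_le_mul_iff_left₀ (pow_pos hmpos (l + 1))]
  calc ((((k ^ 6) ^ (l + 1) * (m - (l + 1)).choose (k - (l + 1)) : ℕ) : ℝ)) * (m : ℝ) ^ (l + 1)
      = ((k : ℝ) ^ 6) ^ (l + 1) * ((((m - (l + 1)).choose (k - (l + 1)) : ℕ) : ℝ) * (m : ℝ) ^ (l + 1)) := by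
        push_cast; ring
    _ ≤ ((k : ℝ) ^ 6) ^ (l + 1) * ((k : ℝ) ^ (l + 1) * (m.choose k : ℝ)) :=
        mul_le_mul_of_nonneg_left hreal (by positivity)
    _ ≤ ((2 * x ^ 2) ^ 6) ^ (l + 1) * ((2 * x ^ 2) ^ (l + 1) * (m.choose k : ℝ)) := by gcongr
    _ = (2 * x ^ 2) ^ (7 * (l + 1)) * (m.choose k : ℝ) := by
        rw [← pow_mul, ← mul_assoc, ← pow_add]
        congr 1
        congr 1
        ring
    _ ≤ epsOf c m * (m.choose k : ℝ) * (m : ℝ) ^ (l + 1) := by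
        rw [DenseRegime.epsOf_eq, hmx]
        rw [show 1 / (4 * (x ^ 16) ^ (c + 1)) * (m.choose k : ℝ) * (x ^ 16) ^ (l + 1) =
            (m.choose k : ℝ) * (x ^ 16) ^ (l + 1) / (4 * (x ^ 16) ^ (c + 1)) by ring]
        rw [le_div_iff₀ (by positivity)]
        calc (2 * x ^ 2) ^ (7 * (l + 1)) * (m.choose k : ℝ) * (4 * (x ^ 16) ^ (c + 1))
            = ((2 * x ^ 2) ^ (7 * (l + 1)) * (4 * (x ^ 16) ^ (c + 1))) * (m.choose k : ℝ) := by ring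
          _ ≤ (x ^ 16) ^ (l + 1) * (m.choose k : ℝ) := mul_le_mul_of_nonneg_right key hC
          _ = (m.choose k : ℝ) * (x ^ 16) ^ (l + 1) := mul_comm _ _

/-- **THE SMALL-CLAUSE DOOR (all `c`; registered ∀-form).** For every `c`, eventually in `m`: a Boolean
function `O` of graphs with a CNF over atoms of `𝒱(lOf m)` whose clauses of MORE than `(kOf m)^6 ≥ m^{3/4}`
atoms are jointly all-absent in `G(m, qOf m)` with probability `≤ epsOf c m` satisfies the single-gate clause
of the line at budget `epsOf c m` (`sg_of_smallClauses` + `fatHit_budget` + `stub_denseRegime c`). [folklore] -/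
theorem sgClause_of_smallClauses : ∀ c : ℕ, ∀ᶠ m : ℕ in atTop, ∀ (O : (KEdge m → Bool) → Bool) (𝒦 : Finset (Finset (Finset (Fin m)))), (∀ L ∈ 𝒦, ∀ Z ∈ L, Z ∈ smallSets (Fin m) (lOf m)) → (∀ x, O x = true ↔ ∀ L ∈ 𝒦, ∃ Z ∈ L, CliquePresent Z x) → prob (qOf m) (fun x : KEdge m → Bool => ∃ L ∈ 𝒦, kOf m ^ 6 < #L ∧ ∀ Z ∈ L, ¬ CliquePresent Z x) ≤ epsOf c m → ∃ 𝒜 ⊆ smallSets (Fin m) (lOf m), (#(lostPos m (kOf m) O 𝒜) : ℝ) ≤ epsOf c m * (m.choose (kOf m) : ℝ) ∧ gainedNeg m (qOf m) O 𝒜 ≤ epsOf c m := by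
  intro c
  filter_upwards [fatHit_budget c, stub_denseRegime c, denseRegime_params c,
    (DenseRegime.tendsto_rpow_sixteenth).eventually_ge_atTop (2 : ℝ)] with m hB hR hP hx2 O 𝒦 h𝒦 hO hbig
  obtain ⟨-, -, hkm, hq0, hq1, -, -, -, -, -⟩ := hR
  obtain ⟨h4, -, -, -⟩ := hP
  have hlk : lOf m + 1 ≤ kOf m := DenseRegime.lOf_add_one_le_kOf hx2
  have hk1 : 1 ≤ kOf m := by omega
  have hs1 : 1 ≤ kOf m ^ 6 := Nat.one_le_pow _ _ hk1
  obtain ⟨𝒜, h𝒜, hlost, hgain⟩ := sg_of_smallClauses m (kOf m) (lOf m) (kOf m ^ 6) (qOf m) hq0 hq1 hs1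
    hkm 𝒦 h𝒦 O hO
  exact ⟨𝒜, h𝒜, le_trans (by exact_mod_cast hlost) hB, hgain.trans hbig⟩

/-- **Corollary: clauses of at most `(kOf m)^6` atoms (registered ∀-form).** For every `c`, eventually in `m`,
every Boolean function of graphs with a CNF over `𝒱(lOf m)`-atoms all of whose clauses have at most `(kOf m)^6`
atoms satisfies the single-gate clause at budget `epsOf c m` — whatever its gate class or monotone complexity
(the gained mass is then ZERO). [folklore] -/
theorem sgClause_of_clauses_card_le : ∀ c : ℕ, ∀ᶠ m : ℕ in atTop, ∀ (O : (KEdge m → Bool) → Bool) (𝒦 : Finset (Finset (Finset (Fin m)))), (∀ L ∈ 𝒦, ∀ Z ∈ L, Z ∈ smallSets (Fin m) (lOf m)) → (∀ L ∈ 𝒦, #L ≤ kOf m ^ 6) → (∀ x, O x = true ↔ ∀ L ∈ 𝒦, ∃ Z ∈ L, CliquePresent Z x) → ∃ 𝒜 ⊆ smallSets (Fin m) (lOf m), (#(lostPos m (kOf m) O 𝒜) : ℝ) ≤ epsOf c m * (m.choose (kOf m) : ℝ) ∧ gainedNeg m (qOf m) O 𝒜 ≤ epsOf c m := by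
  intro c
  filter_upwards [sgClause_of_smallClauses c] with m hm O 𝒦 h𝒦 hsmall hO
  refine hm O 𝒦 h𝒦 hO ?_
  have h0 : prob (qOf m) (fun x : KEdge m → Bool => ∃ L ∈ 𝒦, kOf m ^ 6 < #L ∧ ∀ Z ∈ L, ¬ CliquePresent Z x) = 0 := by
    have he : (fun x : KEdge m → Bool => ∃ L ∈ 𝒦, kOf m ^ 6 < #L ∧ ∀ Z ∈ L, ¬ CliquePresent Z x) =
        fun _ => False := by
      funext x
      apply propext
      constructor
      · rintro ⟨L, hL, hlt, -⟩
        exact absurd (hsmall L hL) (not_le.2 hlt)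
      · exact False.elim
    rw [he, prob_false]
  exact le_of_eq_of_le h0 (epsOf_nonneg c m)

end Summit.PneNP.PneNP.Theorems

end
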